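import Literature.Geometry.DiscreteGeometry.SphericalIsoperimetric
import Literature.MeasureTheory.Hausdorff.SphereArea
import Literature.Analysis.Convexity.BrunnMinkowski
import Mathlib.Analysis.InnerProductSpace.Basic
import HarnessLib

/-!
# The isoperimetric inequality for finite unions of closed balls in `ℝ³` — proof
# (discharge of the named fact `Federer1969_isoperimetricUnionBalls`)

Topic `Literature/Geometry/DiscreteGeometry` (sibling of `SphericalIsoperimetric.lean`, which STATES
the named fact `Federer1969_isoperimetricUnionBalls`: for every finite family of closed balls
`B̄(cᵢ, rᵢ) ⊆ ℝ³` with union `U`, `μHE[2](∂U) < ∞` and `36π · vol(U)² ≤ μHE[2](∂U)³` — Federer,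
*Geometric Measure Theory* 3.2.43 with 3.2.39, specialised).  This file PROVES it:
`Federer1969_isoperimetricUnionBalls_holds`.  Written for the venture `Summits/Ventures/Crystal3D`
(cell `pub-crystal3d`), where the fact is the last cited input of the surface-deficit bound
`C(N) < 6N − 1.67 N^{2/3}` (`surfaceBound_levy_classical`).

## The proof (the outer-Minkowski-content route of Federer 3.2.43 / Gardner 2002 §5, with the
## Minkowski content of a union of balls computed by hand)

1. **Area of `∂U` exactly.**  `∂U` is partitioned into the Borel pieces
   `Pₖ = ∂U ∩ S(cₖ, rₖ) ∩ {x | x ∉ B̄(cⱼ, rⱼ) for j < k}` ("the first ball containing the point is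
   the `k`-th"); with the direction sets `Dₖ = {u ∈ S² | cₖ + rₖ u ∈ Pₖ}` one has
   `μHE[2](∂U) = Σₖ μHE[2](Pₖ) = Σₖ 4π rₖ² · sphereFraction Dₖ` (translation invariance and
   `2`-homogeneity of `μHE[2]`, and `μHE[2] = 4π · sphereFraction` on `S²` — the tree's `κ = 1`
   theorem `Literature.MeasureTheory.Hausdorff.comap_euclideanHausdorff_eq_toSphere`; pieces on
   spheres of radius `≤ 0` are empty or a point).
2. **The outer shell.**  For `ε > 0`, every `x ∈ (U + B̄(0,ε)) \ U` has a nearest point `p ∈ U`;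
   if `k` is the first ball containing `p` then `p ∈ Pₖ`, `x − cₖ` is a positive multiple of
   `p − cₖ` (equality in the triangle inequality, `inner_eq_norm_mul_iff_real`) and
   `rₖ < ‖x − cₖ‖ ≤ rₖ + ε`.  Hence `(U + B̄(0,ε)) \ U ⊆ ⋃ₖ cₖ + (rayCone Dₖ ∩ (B̄(0,rₖ+ε) \ B̄(0,rₖ)))`
   and, by the `3`-homogeneity of the cone volumes `vol(B̄(0,R) ∩ rayCone D) = R³ (4π/3) σ(D)`,
   `vol((U + B̄(0,ε)) \ U) ≤ Σₖ (4π/3)((rₖ+ε)³ − rₖ³) · sphereFraction Dₖ`.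
3. **Brunn–Minkowski** (`Literature.Analysis.Convexity.brunnMinkowski_pow_of_isCompact`, proved in
   the tree from Prékopa–Leindler): `vol(U + B̄(0,ε)) ≥ (4π/3)(ρ + ε)³` where `(4π/3)ρ³ = vol U`.
4. Comparing 2 and 3, dividing by `ε` and letting `ε → 0⁺`: `4πρ² ≤ Σₖ 4π rₖ² σₖ = μHE[2](∂U)`;
   cubing gives `36π vol(U)² ≤ μHE[2](∂U)³`.

Everything except the final theorem is a `private` helper (standard facts, `[folklore]`).
Balls of radius `< 0` (empty) and `= 0` (points) are allowed by the statement and handled.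

## What is NOT here

No general isoperimetric inequality (arbitrary sets / Minkowski content / finite perimeter —
Federer 3.2.43, 4.5.9 (31)), no other dimension, no equality case.

## References

* H. Federer, *Geometric Measure Theory*, Springer 1969, §3.2.43, §3.2.39. [`Federer1969`]
* R. J. Gardner, *The Brunn–Minkowski inequality*, Bull. AMS 39 (2002), §5 (surface area as the
  outer Minkowski content (13) and the isoperimetric inequality from Brunn–Minkowski). [`Gardner2002`]
-/

noncomputable section

namespace Literature.Geometry.DiscreteGeometry

open Real Metric Set Filter
open _root_.MeasureTheory _root_.MeasureTheory.Measure
open scoped ENNReal NNReal Pointwise Topology RealInnerProductSpace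

/-! ### Cone volumes over a set of directions -/

/-- For a set of unit vectors `A`, `B(0,1) ∩ rayCone A = (0,1) • A`. [folklore] -/
private theorem ball_inter_rayCone_eq_smul {A : Set (EuclideanSpace ℝ (Fin 3))} (hA : A ⊆ sphere (0 : (EuclideanSpace ℝ (Fin 3))) 1) :
    ball (0 : (EuclideanSpace ℝ (Fin 3))) 1 ∩ rayCone A = Set.Ioo (0 : ℝ) 1 • A := by
  ext x
  constructor
  · rintro ⟨hx1, hx0, hxA⟩
    rw [mem_ball_zero_iff] at hx1
    refine Set.mem_smul.2 ⟨‖x‖, ⟨norm_pos_iff.2 hx0, hx1⟩, ‖x‖⁻¹ • x, hxA, ?_⟩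
    rw [smul_smul, mul_inv_cancel₀ (norm_ne_zero_iff.2 hx0), one_smul]
  · intro hx
    obtain ⟨t, ht, a, haA, rfl⟩ := Set.mem_smul.1 hx
    have ha : ‖a‖ = 1 := mem_sphere_zero_iff_norm.1 (hA haA)
    have hn : ‖t • a‖ = t := by
      rw [norm_smul, ha, mul_one, Real.norm_of_nonneg ht.1.le]
    refine ⟨?_, ?_, ?_⟩
    · rw [mem_ball_zero_iff, hn]
      exact ht.2
    · rw [← norm_ne_zero_iff, hn]
      exact ht.1.ne'
    · show ‖t • a‖⁻¹ • (t • a) ∈ A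
      rw [hn, smul_smul, inv_mul_cancel₀ ht.1.ne', one_smul]
      exact haA

/-- The volume of the unit ball of `ℝ³` as a real number: `4π/3`. [folklore] -/
private theorem volume_unitBall_toReal : (volume (ball (0 : (EuclideanSpace ℝ (Fin 3))) (1 : ℝ))).toReal = π * 4 / 3 := by
  rw [EuclideanSpace.volume_ball_fin_three, ENNReal.ofReal_one, one_pow, one_mul,
    ENNReal.toReal_ofReal (by positivity)]

/-- `vol(B(0,1) ∩ rayCone D) = (4π/3) · sphereFraction D`. [folklore] -/
private theorem volume_ball_inter_rayCone (D : Set (EuclideanSpace ℝ (Fin 3))) :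
    volume (ball (0 : (EuclideanSpace ℝ (Fin 3))) 1 ∩ rayCone D) =
      ENNReal.ofReal (sphereFraction D * (π * 4 / 3)) := by
  have hfin : volume (ball (0 : (EuclideanSpace ℝ (Fin 3))) 1 ∩ rayCone D) ≠ ⊤ :=
    (lt_of_le_of_lt (measure_mono inter_subset_left) measure_ball_lt_top).ne
  rw [← ENNReal.ofReal_toReal hfin]
  congr 1
  rw [sphereFraction_eq, volume_unitBall_toReal, div_mul_cancel₀ _ (by positivity)]

/-- `rayCone D` is invariant under positive dilations. [folklore] -/
private theorem smul_mem_rayCone_iff {D : Set (EuclideanSpace ℝ (Fin 3))} {t : ℝ} (ht : 0 < t) (x : (EuclideanSpace ℝ (Fin 3))) :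
    t • x ∈ rayCone D ↔ x ∈ rayCone D := by
  have key : ‖t • x‖⁻¹ • (t • x) = ‖x‖⁻¹ • x := by
    rw [norm_smul, Real.norm_of_nonneg ht.le, smul_smul, mul_inv]
    congr 1
    field_simp
  have h0 : t • x ≠ 0 ↔ x ≠ 0 := by
    rw [Ne, smul_eq_zero, not_or]
    exact ⟨fun h => h.2, fun h => ⟨ht.ne', h⟩⟩
  show (t • x ≠ 0 ∧ ‖t • x‖⁻¹ • (t • x) ∈ D) ↔ (x ≠ 0 ∧ ‖x‖⁻¹ • x ∈ D)
  rw [key, h0]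

/-- `B(0,R) ∩ rayCone D = R • (B(0,1) ∩ rayCone D)` for `R > 0`. [folklore] -/
private theorem ball_inter_rayCone_smul (D : Set (EuclideanSpace ℝ (Fin 3))) {R : ℝ} (hR : 0 < R) :
    ball (0 : (EuclideanSpace ℝ (Fin 3))) R ∩ rayCone D = R • (ball (0 : (EuclideanSpace ℝ (Fin 3))) 1 ∩ rayCone D) := by
  ext x
  rw [Set.mem_smul_set_iff_inv_smul_mem₀ hR.ne', mem_inter_iff, mem_inter_iff,
    smul_mem_rayCone_iff (inv_pos.2 hR), mem_ball_zero_iff, mem_ball_zero_iff, norm_smul,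
    norm_inv, Real.norm_of_nonneg hR.le, inv_mul_lt_iff₀ hR, mul_one]

/-- `vol(B(0,R) ∩ rayCone D) = R³ · (4π/3) · sphereFraction D` for `R > 0`. [folklore] -/
private theorem volume_ball_inter_rayCone_of_pos (D : Set (EuclideanSpace ℝ (Fin 3))) {R : ℝ} (hR : 0 < R) :
    volume (ball (0 : (EuclideanSpace ℝ (Fin 3))) R ∩ rayCone D) =
      ENNReal.ofReal (R ^ 3 * (sphereFraction D * (π * 4 / 3))) := by
  rw [ball_inter_rayCone_smul D hR, Measure.addHaar_smul, finrank_euclideanSpace_fin,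
    volume_ball_inter_rayCone, abs_of_pos (pow_pos hR 3), ← ENNReal.ofReal_mul (by positivity)]

/-- `vol(B̄(0,R) ∩ rayCone D) = R³ · (4π/3) · sphereFraction D` for `R ≥ 0` (spheres are null;
the origin is not in the cone). [folklore] -/
private theorem volume_closedBall_inter_rayCone (D : Set (EuclideanSpace ℝ (Fin 3))) {R : ℝ} (hR : 0 ≤ R) :
    volume (closedBall (0 : (EuclideanSpace ℝ (Fin 3))) R ∩ rayCone D) =
      ENNReal.ofReal (R ^ 3 * (sphereFraction D * (π * 4 / 3))) := by
  rcases hR.eq_or_lt with rfl | hR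
  · have h0 : closedBall (0 : (EuclideanSpace ℝ (Fin 3))) 0 ∩ rayCone D = ∅ := by
      rw [closedBall_zero, Set.eq_empty_iff_forall_notMem]
      rintro x ⟨hx, hx'⟩
      exact hx'.1 (mem_singleton_iff.1 hx)
    rw [h0, measure_empty]
    simp
  · apply le_antisymm
    · calc volume (closedBall (0 : (EuclideanSpace ℝ (Fin 3))) R ∩ rayCone D)
          ≤ volume ((ball (0 : (EuclideanSpace ℝ (Fin 3))) R ∩ rayCone D) ∪ sphere 0 R) := by
            refine measure_mono ?_
            rintro x ⟨hx, hx'⟩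
            rw [← ball_union_sphere] at hx
            rcases hx with hx | hx
            · exact Or.inl ⟨hx, hx'⟩
            · exact Or.inr hx
        _ ≤ volume (ball (0 : (EuclideanSpace ℝ (Fin 3))) R ∩ rayCone D) + volume (sphere (0 : (EuclideanSpace ℝ (Fin 3))) R) :=
            measure_union_le _ _
        _ = ENNReal.ofReal (R ^ 3 * (sphereFraction D * (π * 4 / 3))) := by
            rw [Measure.addHaar_sphere, add_zero, volume_ball_inter_rayCone_of_pos D hR]
    · rw [← volume_ball_inter_rayCone_of_pos D hR]
      exact measure_mono (inter_subset_inter_left _ ball_subset_closedBall)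

/-- The empty set of directions has fraction `0`. [folklore] -/
private theorem sphereFraction_empty : sphereFraction (∅ : Set (EuclideanSpace ℝ (Fin 3))) = 0 := by
  have h : rayCone (∅ : Set (EuclideanSpace ℝ (Fin 3))) = ∅ := Set.eq_empty_iff_forall_notMem.2 fun x hx => hx.2
  rw [sphereFraction_eq, h, inter_empty, measure_empty, ENNReal.toReal_zero, zero_div]

/-- The cone over a measurable set of directions is measurable. [folklore] -/
private theorem measurableSet_rayCone {D : Set (EuclideanSpace ℝ (Fin 3))} (hD : MeasurableSet D) :
    MeasurableSet (rayCone D) := by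
  have h1 : MeasurableSet {x : (EuclideanSpace ℝ (Fin 3)) | x ≠ 0} := (measurableSet_singleton (0 : (EuclideanSpace ℝ (Fin 3)))).compl
  have hf : Measurable fun x : (EuclideanSpace ℝ (Fin 3)) => ‖x‖⁻¹ • x := (measurable_norm.inv).smul measurable_id
  exact h1.inter (hf hD)

/-! ### `μHE[2]` on spheres through `sphereFraction` -/

/-- For a measurable set of unit vectors `A ⊆ S²`, `μHE[2] A = 4π · sphereFraction A`
(the tree's `κ = 1` theorem `comap_euclideanHausdorff_eq_toSphere` and Mathlib's
`toSphere s = 3 · vol((0,1) • s)`). [folklore] -/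
private theorem euclideanHausdorff_eq_sphereFraction {A : Set (EuclideanSpace ℝ (Fin 3))} (hA : A ⊆ sphere (0 : (EuclideanSpace ℝ (Fin 3))) 1)
    (hm : MeasurableSet A) :
    (μHE[2] : Measure (EuclideanSpace ℝ (Fin 3))) A = ENNReal.ofReal (4 * π * sphereFraction A) := by
  have hE : Module.finrank ℝ (EuclideanSpace ℝ (Fin 3)) = 3 := finrank_euclideanSpace_fin
  set s : Set (sphere (0 : (EuclideanSpace ℝ (Fin 3))) 1) := Subtype.val ⁻¹' A with hs
  have hsm : MeasurableSet s := measurable_subtype_coe hm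
  have himg : (Subtype.val '' s) = A := by
    rw [hs, Subtype.image_preimage_coe, Set.inter_eq_right.2 hA]
  have hme := MeasurableEmbedding.subtype_coe
    ((isClosed_sphere : IsClosed (sphere (0 : (EuclideanSpace ℝ (Fin 3))) 1)).measurableSet)
  have h1 : (μHE[2] : Measure (EuclideanSpace ℝ (Fin 3))) A = ((μHE[2] : Measure (EuclideanSpace ℝ (Fin 3))).comap Subtype.val) s := by
    rw [hme.comap_apply, himg]
  rw [h1, Literature.MeasureTheory.Hausdorff.comap_euclideanHausdorff_eq_toSphere hE,
    Measure.toSphere_apply' _ hsm, himg, hE, ← ball_inter_rayCone_eq_smul hA]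
  rw [volume_ball_inter_rayCone, Nat.cast_ofNat, show (3 : ℝ≥0∞) = ENNReal.ofReal 3 by norm_num,
    ← ENNReal.ofReal_mul (by norm_num)]
  congr 1
  ring

/-- Area of a translated and scaled measurable set of directions `D ⊆ S²`:
`μHE[2] (a + ρ • D) = 4π ρ² · sphereFraction D` (`ρ > 0`). [folklore] -/
private theorem euclideanHausdorff_image_affine {D : Set (EuclideanSpace ℝ (Fin 3))} (hD : D ⊆ sphere (0 : (EuclideanSpace ℝ (Fin 3))) 1)
    (hm : MeasurableSet D) (a : (EuclideanSpace ℝ (Fin 3))) {ρ : ℝ} (hρ : 0 < ρ) :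
    (μHE[2] : Measure (EuclideanSpace ℝ (Fin 3))) ((fun u : (EuclideanSpace ℝ (Fin 3)) => a + ρ • u) '' D) =
      ENNReal.ofReal (4 * π * ρ ^ 2 * sphereFraction D) := by
  have himg : (fun u : (EuclideanSpace ℝ (Fin 3)) => a + ρ • u) '' D = (fun u : (EuclideanSpace ℝ (Fin 3)) => a + u) '' (ρ • D) := by
    rw [← image_smul, image_image]
  have hiso : Isometry (fun u : (EuclideanSpace ℝ (Fin 3)) => a + u) := fun x y => edist_add_left a x y
  rw [himg, hiso.euclideanHausdorffMeasure_image, Measure.euclideanHausdorffMeasure_smul₀ 2 hρ.ne',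
    euclideanHausdorff_eq_sphereFraction hD hm, ENNReal.smul_def, smul_eq_mul, ENNReal.coe_pow,
    ← ENNReal.ofReal_coe_nnreal, coe_nnnorm, Real.norm_eq_abs, abs_of_pos hρ,
    ← ENNReal.ofReal_pow hρ.le, ← ENNReal.ofReal_mul (by positivity)]
  congr 1
  ring

/-- A point has `μHE[2]`-measure zero. [folklore] -/
private theorem euclideanHausdorff_two_singleton (x : (EuclideanSpace ℝ (Fin 3))) : (μHE[2] : Measure (EuclideanSpace ℝ (Fin 3))) {x} = 0 := by
  rcases Measure.euclideanHausdorffMeasure_zero_or_top (show 0 < 2 by norm_num) ({x} : Set (EuclideanSpace ℝ (Fin 3)))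
    with h | h
  · exact h
  · exfalso
    rw [Measure.euclideanHausdorffMeasure_zero, Measure.hausdorffMeasure_zero_singleton] at h
    exact ENNReal.one_ne_top h

/-! ### A Borel partition of the boundary of a finite union of balls into sphere pieces -/

section Pieces

variable {m : ℕ} (c : Fin m → (EuclideanSpace ℝ (Fin 3))) (r : Fin m → ℝ)

/-- The union of the closed balls is compact. [folklore] -/
private theorem isCompact_iUnion_closedBall' : IsCompact (⋃ j, closedBall (c j) (r j)) :=
  isCompact_iUnion fun _ => isCompact_closedBall _ _

/-- Each open ball of the family lies in the interior of the union. [folklore] -/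
private theorem ball_subset_interior_iUnion (k : Fin m) :
    ball (c k) (r k) ⊆ interior (⋃ j, closedBall (c j) (r j)) :=
  ball_subset_interior_closedBall.trans
    (interior_mono (subset_iUnion (fun j => closedBall (c j) (r j)) k))

/-- **First-ball index.** Every point of the union has a least index `k` with
`x ∈ B̄(c k, r k)`. [folklore] -/
private theorem exists_least_index {x : (EuclideanSpace ℝ (Fin 3))} (hx : x ∈ ⋃ j, closedBall (c j) (r j)) :
    ∃ k, x ∈ closedBall (c k) (r k) ∧ ∀ j < k, x ∉ closedBall (c j) (r j) := by
  obtain ⟨j₀, hj₀⟩ := mem_iUnion.1 hx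
  obtain ⟨k, hk, hmin⟩ :=
    (wellFounded_lt (α := Fin m)).has_min {j | x ∈ closedBall (c j) (r j)} ⟨j₀, hj₀⟩
  exact ⟨k, hk, fun j hj hjS => hmin j hjS hj⟩

/-- A boundary point of the union lying in `B̄(c k, r k)` lies on the sphere `S(c k, r k)`
(the open ball is interior). [folklore] -/
private theorem mem_sphere_of_mem_frontier {x : (EuclideanSpace ℝ (Fin 3))} {k : Fin m}
    (hx : x ∈ frontier (⋃ j, closedBall (c j) (r j))) (hk : x ∈ closedBall (c k) (r k)) :
    x ∈ sphere (c k) (r k) := by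
  rw [mem_sphere]
  refine le_antisymm (mem_closedBall.1 hk) (not_lt.1 fun hlt => hx.2 ?_)
  exact ball_subset_interior_iUnion c r k (mem_ball.2 hlt)

/-- **The pieces cover the boundary**: with
`P k = ∂U ∩ (S(c k, r k) ∩ {x | ∀ j < k, x ∉ B̄(c j, r j)})`, `∂U = ⋃ₖ P k`. [folklore] -/
private theorem frontier_eq_iUnion_pieces (P : Fin m → Set (EuclideanSpace ℝ (Fin 3)))
    (hP : ∀ k, P k = frontier (⋃ j, closedBall (c j) (r j)) ∩
      (sphere (c k) (r k) ∩ {x | ∀ j < k, x ∉ closedBall (c j) (r j)})) :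
    frontier (⋃ j, closedBall (c j) (r j)) = ⋃ k, P k := by
  apply Subset.antisymm
  · intro x hx
    have hxU : x ∈ ⋃ j, closedBall (c j) (r j) :=
      (isCompact_iUnion_closedBall' c r).isClosed.frontier_subset hx
    obtain ⟨k, hk, hmin⟩ := exists_least_index c r hxU
    refine mem_iUnion.2 ⟨k, ?_⟩
    rw [hP]
    exact ⟨hx, mem_sphere_of_mem_frontier c r hx hk, hmin⟩
  · refine iUnion_subset fun k => ?_
    rw [hP]
    exact inter_subset_left

/-- **The pieces are pairwise disjoint.** [folklore] -/
private theorem pairwise_disjoint_pieces (P : Fin m → Set (EuclideanSpace ℝ (Fin 3)))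
    (hP : ∀ k, P k = frontier (⋃ j, closedBall (c j) (r j)) ∩
      (sphere (c k) (r k) ∩ {x | ∀ j < k, x ∉ closedBall (c j) (r j)})) :
    Pairwise (Function.onFun Disjoint P) := by
  intro k k' hkk'
  rw [Function.onFun, Set.disjoint_left]
  intro x hxk hxk'
  rw [hP] at hxk hxk'
  rcases lt_or_gt_of_ne hkk' with hlt | hlt
  · exact hxk'.2.2 k hlt (sphere_subset_closedBall hxk.2.1)
  · exact hxk.2.2 k' hlt (sphere_subset_closedBall hxk'.2.1)

/-- The pieces are measurable (Borel). [folklore] -/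
private theorem measurableSet_piece (P : Fin m → Set (EuclideanSpace ℝ (Fin 3)))
    (hP : ∀ k, P k = frontier (⋃ j, closedBall (c j) (r j)) ∩
      (sphere (c k) (r k) ∩ {x | ∀ j < k, x ∉ closedBall (c j) (r j)})) (k : Fin m) :
    MeasurableSet (P k) := by
  rw [hP]
  have h3 : {x : (EuclideanSpace ℝ (Fin 3)) | ∀ j < k, x ∉ closedBall (c j) (r j)} = ⋂ j ∈ {j | j < k}, (closedBall (c j) (r j))ᶜ := by
    ext x; simp
  refine isClosed_frontier.measurableSet.inter (isClosed_sphere.measurableSet.inter ?_)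
  rw [h3]
  exact MeasurableSet.biInter (Set.to_countable _) fun j _ => isClosed_closedBall.measurableSet.compl

/-- The direction sets `D k = {u ∈ S² | c k + r k • u ∈ P k}` are measurable. [folklore] -/
private theorem measurableSet_dirs (P D : Fin m → Set (EuclideanSpace ℝ (Fin 3)))
    (hP : ∀ k, P k = frontier (⋃ j, closedBall (c j) (r j)) ∩
      (sphere (c k) (r k) ∩ {x | ∀ j < k, x ∉ closedBall (c j) (r j)}))
    (hD : ∀ k, D k = {u : (EuclideanSpace ℝ (Fin 3)) | ‖u‖ = 1 ∧ c k + r k • u ∈ P k}) (k : Fin m) :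
    MeasurableSet (D k) := by
  rw [hD]
  have hcont : Continuous fun u : (EuclideanSpace ℝ (Fin 3)) => c k + r k • u := by fun_prop
  exact (isClosed_eq continuous_norm continuous_const).measurableSet.inter
    (hcont.measurable (measurableSet_piece c r P hP k))

/-- The direction sets consist of unit vectors. [folklore] -/
private theorem dirs_subset_sphere (P D : Fin m → Set (EuclideanSpace ℝ (Fin 3)))
    (hD : ∀ k, D k = {u : (EuclideanSpace ℝ (Fin 3)) | ‖u‖ = 1 ∧ c k + r k • u ∈ P k}) (k : Fin m) :
    D k ⊆ sphere (0 : (EuclideanSpace ℝ (Fin 3))) 1 := by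
  intro u hu
  rw [hD] at hu
  exact mem_sphere_zero_iff_norm.2 hu.1

/-- For `r k > 0`, the piece is the affine image of its direction set. [folklore] -/
private theorem piece_eq_image_of_pos (P D : Fin m → Set (EuclideanSpace ℝ (Fin 3)))
    (hP : ∀ k, P k = frontier (⋃ j, closedBall (c j) (r j)) ∩
      (sphere (c k) (r k) ∩ {x | ∀ j < k, x ∉ closedBall (c j) (r j)}))
    (hD : ∀ k, D k = {u : (EuclideanSpace ℝ (Fin 3)) | ‖u‖ = 1 ∧ c k + r k • u ∈ P k}) {k : Fin m} (hk : 0 < r k) :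
    P k = (fun u : (EuclideanSpace ℝ (Fin 3)) => c k + r k • u) '' D k := by
  apply Subset.antisymm
  · intro x hx
    have hxs : x ∈ sphere (c k) (r k) := by rw [hP] at hx; exact hx.2.1
    have hdist : dist x (c k) = r k := mem_sphere.1 hxs
    have hx_eq : c k + r k • ((r k)⁻¹ • (x - c k)) = x := by
      rw [smul_smul, mul_inv_cancel₀ hk.ne', one_smul, add_sub_cancel]
    refine ⟨(r k)⁻¹ • (x - c k), ?_, hx_eq⟩
    rw [hD]
    refine ⟨?_, by rw [hx_eq]; exact hx⟩
    rw [norm_smul, norm_inv, Real.norm_of_nonneg hk.le, ← dist_eq_norm, hdist,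
      inv_mul_cancel₀ hk.ne']
  · rintro _ ⟨u, hu, rfl⟩
    rw [hD] at hu
    exact hu.2

/-- **Area of one piece**: `μHE[2] (P k) = 4π (r k)² · sphereFraction (D k)` — for `r k > 0` by
translation invariance and `2`-homogeneity; for `r k = 0` the piece is at most a point; for
`r k < 0` it is empty and so is `D k`. [folklore] -/
private theorem euclideanHausdorff_piece (P D : Fin m → Set (EuclideanSpace ℝ (Fin 3)))
    (hP : ∀ k, P k = frontier (⋃ j, closedBall (c j) (r j)) ∩
      (sphere (c k) (r k) ∩ {x | ∀ j < k, x ∉ closedBall (c j) (r j)}))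
    (hD : ∀ k, D k = {u : (EuclideanSpace ℝ (Fin 3)) | ‖u‖ = 1 ∧ c k + r k • u ∈ P k}) (k : Fin m) :
    (μHE[2] : Measure (EuclideanSpace ℝ (Fin 3))) (P k) = ENNReal.ofReal (4 * π * r k ^ 2 * sphereFraction (D k)) := by
  rcases lt_trichotomy (r k) 0 with hneg | hzero | hpos
  · -- empty sphere, empty direction set
    have hPk : P k = ∅ := by
      rw [hP, Set.eq_empty_iff_forall_notMem]
      rintro x ⟨-, hxs, -⟩
      have := mem_sphere.1 hxs
      linarith [dist_nonneg (x := x) (y := c k)]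
    have hDk : D k = ∅ := by
      rw [hD, Set.eq_empty_iff_forall_notMem]
      rintro u ⟨-, hu⟩
      rw [hPk] at hu
      exact hu
    rw [hPk, hDk, measure_empty, sphereFraction_empty, mul_zero, ENNReal.ofReal_zero]
  · -- a point
    have hPk : P k ⊆ {c k} := by
      rw [hP]
      rintro x ⟨-, hxs, -⟩
      rw [hzero, sphere_zero] at hxs
      exact hxs
    rw [hzero, measure_mono_null hPk (euclideanHausdorff_two_singleton (c k))]
    simp
  · rw [piece_eq_image_of_pos c r P D hP hD hpos,
      euclideanHausdorff_image_affine (dirs_subset_sphere c r P D hD k)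
        (measurableSet_dirs c r P D hP hD k) (c k) hpos]

/-- **Area of the boundary through the pieces**:
`μHE[2] (∂U) = Σₖ 4π (r k)² · sphereFraction (D k)` (a finite real number). [folklore] -/
private theorem euclideanHausdorff_frontier_eq (P D : Fin m → Set (EuclideanSpace ℝ (Fin 3)))
    (hP : ∀ k, P k = frontier (⋃ j, closedBall (c j) (r j)) ∩
      (sphere (c k) (r k) ∩ {x | ∀ j < k, x ∉ closedBall (c j) (r j)}))
    (hD : ∀ k, D k = {u : (EuclideanSpace ℝ (Fin 3)) | ‖u‖ = 1 ∧ c k + r k • u ∈ P k}) :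
    (μHE[2] : Measure (EuclideanSpace ℝ (Fin 3))) (frontier (⋃ j, closedBall (c j) (r j))) =
      ENNReal.ofReal (∑ k, 4 * π * r k ^ 2 * sphereFraction (D k)) := by
  rw [frontier_eq_iUnion_pieces c r P hP,
    measure_iUnion (pairwise_disjoint_pieces c r P hP) (measurableSet_piece c r P hP),
    tsum_fintype, ENNReal.ofReal_sum_of_nonneg fun k _ => ?_]
  · exact Finset.sum_congr rfl fun k _ => euclideanHausdorff_piece c r P D hP hD k
  · exact mul_nonneg (by positivity) (sphereFraction_nonneg _)

end Pieces

/-! ### The outer shell `(U + B̄(0,ε)) \ U` lies over the pieces -/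

section Shell

variable {m : ℕ} (c : Fin m → (EuclideanSpace ℝ (Fin 3))) (r : Fin m → ℝ)

/-- For `r k < 0` the direction set `D k` is empty (the sphere is empty). [folklore] -/
private theorem dirs_eq_empty_of_neg (P D : Fin m → Set (EuclideanSpace ℝ (Fin 3)))
    (hP : ∀ k, P k = frontier (⋃ j, closedBall (c j) (r j)) ∩
      (sphere (c k) (r k) ∩ {x | ∀ j < k, x ∉ closedBall (c j) (r j)}))
    (hD : ∀ k, D k = {u : (EuclideanSpace ℝ (Fin 3)) | ‖u‖ = 1 ∧ c k + r k • u ∈ P k}) {k : Fin m} (hk : r k < 0) :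
    D k = ∅ := by
  rw [hD, Set.eq_empty_iff_forall_notMem]
  rintro u ⟨-, hu⟩
  rw [hP] at hu
  have := mem_sphere.1 hu.2.1
  linarith [dist_nonneg (x := c k + r k • u) (y := c k)]

/-- **Nearest points and the outer shell.** For any `ε`, every point `x` of `(U + B̄(0,ε)) \ U`
lies radially over the piece containing a nearest point `p ∈ U` of `x`: if `k` is the first ball
containing `p`, then `p ∈ ∂U ∩ S(c k, r k)`, `x - c k` is a positive multiple of `p - c k`
(equality in the triangle inequality), and `r k < ‖x - c k‖ ≤ r k + ε`. Hence
`(U + B̄(0,ε)) \ U ⊆ ⋃ₖ c k + (rayCone (D k) ∩ (B̄(0, r k + ε) \ B̄(0, r k)))`. [folklore] -/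
private theorem add_closedBall_diff_subset (P D : Fin m → Set (EuclideanSpace ℝ (Fin 3)))
    (hP : ∀ k, P k = frontier (⋃ j, closedBall (c j) (r j)) ∩
      (sphere (c k) (r k) ∩ {x | ∀ j < k, x ∉ closedBall (c j) (r j)}))
    (hD : ∀ k, D k = {u : (EuclideanSpace ℝ (Fin 3)) | ‖u‖ = 1 ∧ c k + r k • u ∈ P k}) (ε : ℝ) :
    ((⋃ j, closedBall (c j) (r j)) + closedBall (0 : (EuclideanSpace ℝ (Fin 3))) ε) \ (⋃ j, closedBall (c j) (r j)) ⊆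
      ⋃ k, (c k +ᵥ (rayCone (D k) ∩ (closedBall (0 : (EuclideanSpace ℝ (Fin 3))) (r k + ε) \ closedBall 0 (r k)))) := by
  rintro x ⟨hxW, hxU⟩
  set U := ⋃ j, closedBall (c j) (r j) with hU
  obtain ⟨y, hy, z, hz, hyz⟩ := hxW
  have hUc : IsCompact U := isCompact_iUnion_closedBall' c r
  obtain ⟨p, hpU, hp⟩ := hUc.exists_infDist_eq_dist ⟨y, hy⟩ x
  -- `δ = dist x p = dist(x, U) ∈ (0, ε]`
  set δ := dist x p with hδ
  have hmin : ∀ q ∈ U, δ ≤ dist x q := fun q hq => by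
    rw [← hp]; exact infDist_le_dist_of_mem hq
  have hδε : δ ≤ ε := by
    calc δ ≤ dist x y := hmin y hy
      _ = ‖z‖ := by rw [← hyz, dist_eq_norm, add_sub_cancel_left]
      _ ≤ ε := mem_closedBall_zero_iff.1 hz
  have hδpos : 0 < δ := dist_pos.2 fun h => hxU (h ▸ hpU)
  -- the first ball containing `p`
  obtain ⟨k, hk, hkmin⟩ := exists_least_index c r hpU
  have hrk : 0 ≤ r k := dist_nonneg.trans (mem_closedBall.1 hk)
  have hxk : r k < dist x (c k) :=
    not_le.1 fun h => hxU (mem_iUnion.2 ⟨k, mem_closedBall.2 h⟩)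
  have hxc : x ≠ c k := fun h => by
    rw [h, dist_self] at hxk
    linarith
  -- (B) `dist x (c k) = r k + δ`
  have hB : dist x (c k) = r k + δ := by
    apply le_antisymm
    · calc dist x (c k) ≤ dist x p + dist p (c k) := dist_triangle _ _ _
        _ ≤ δ + r k := by rw [hδ]; exact add_le_add le_rfl (mem_closedBall.1 hk)
        _ = r k + δ := add_comm _ _
    · set d := dist x (c k) with hd
      have hd0 : 0 < d := lt_of_le_of_lt hrk hxk
      set q : (EuclideanSpace ℝ (Fin 3)) := c k + (r k / d) • (x - c k) with hq
      have hqU : q ∈ U := by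
        refine mem_iUnion.2 ⟨k, mem_closedBall.2 (le_of_eq ?_)⟩
        rw [hq, dist_eq_norm, add_sub_cancel_left, norm_smul,
          Real.norm_of_nonneg (div_nonneg hrk hd0.le), ← dist_eq_norm, ← hd,
          div_mul_cancel₀ _ hd0.ne']
      have hxq : dist x q = d - r k := by
        have h1 : x - q = (1 - r k / d) • (x - c k) := by
          rw [hq, sub_smul, one_smul]
          abel
        have h2 : 0 ≤ 1 - r k / d := by
          rw [sub_nonneg, div_le_one hd0]
          exact hxk.le
        rw [dist_eq_norm, h1, norm_smul, Real.norm_of_nonneg h2, ← dist_eq_norm, ← hd, sub_mul,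
          one_mul, div_mul_cancel₀ _ hd0.ne']
      have := hmin q hqU
      linarith
  -- (C) collinearity: `p = c k + r k • u` with `u = (r k + δ)⁻¹ • (x - c k)`
  set a : (EuclideanSpace ℝ (Fin 3)) := x - p with ha
  set b : (EuclideanSpace ℝ (Fin 3)) := p - c k with hb
  have hab : a + b = x - c k := by rw [ha, hb]; abel
  have hna : ‖a‖ = δ := by rw [ha, hδ, dist_eq_norm]
  have hnb_le : ‖b‖ ≤ r k := by rw [hb, ← dist_eq_norm]; exact mem_closedBall.1 hk
  have hnab : ‖a + b‖ = r k + δ := by rw [hab, ← dist_eq_norm, hB]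
  have hnb : ‖b‖ = r k := by
    apply le_antisymm hnb_le
    have := norm_add_le a b
    linarith
  have hinner : ⟪a, b⟫ = ‖a‖ * ‖b‖ := by
    have h1 : ‖a + b‖ ^ 2 = (‖a‖ + ‖b‖) ^ 2 := by rw [hnab, hna, hnb, add_comm]
    rw [norm_add_sq_real] at h1
    nlinarith [h1]
  have hcol : ‖b‖ • a = ‖a‖ • b := (inner_eq_norm_mul_iff_real).1 hinner
  have hkey : (r k) • (x - c k) = (r k + δ) • b := by
    rw [← hab, smul_add, ← hnb, hcol, hna, add_smul, add_comm]
  have hrδ : 0 < r k + δ := by linarith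
  set u : (EuclideanSpace ℝ (Fin 3)) := (r k + δ)⁻¹ • (x - c k) with hu
  have hu1 : ‖u‖ = 1 := by
    rw [hu, norm_smul, norm_inv, Real.norm_of_nonneg hrδ.le, ← dist_eq_norm, hB,
      inv_mul_cancel₀ hrδ.ne']
  have hpu : c k + r k • u = p := by
    rw [hu, smul_smul, mul_comm, mul_smul, hkey, smul_smul, inv_mul_cancel₀ hrδ.ne', one_smul, hb,
      add_sub_cancel]
  -- (D) `p ∈ ∂U`: otherwise a point of `U` on the segment `[p, x]` is closer to `x`
  have hpfr : p ∈ frontier U := by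
    refine ⟨subset_closure hpU, fun hpint => ?_⟩
    obtain ⟨η, hη, hball⟩ := Metric.mem_nhds_iff.1 (mem_interior_iff_mem_nhds.1 hpint)
    set s := min (η / 2) δ with hs
    have hs0 : 0 < s := lt_min (half_pos hη) hδpos
    have hsη : s < η := lt_of_le_of_lt (min_le_left _ _) (half_lt_self hη)
    have hsδ : s ≤ δ := min_le_right _ _
    set q : (EuclideanSpace ℝ (Fin 3)) := p + (s / δ) • (x - p) with hq
    have hqU : q ∈ U := by
      refine hball (mem_ball.2 ?_)
      rw [hq, dist_eq_norm, add_sub_cancel_left, norm_smul,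
        Real.norm_of_nonneg (div_nonneg hs0.le hδpos.le), ← dist_eq_norm, ← hδ,
        div_mul_cancel₀ _ hδpos.ne']
      exact hsη
    have hxq : dist x q = δ - s := by
      have h1 : x - q = (1 - s / δ) • (x - p) := by
        rw [hq, sub_smul, one_smul]
        abel
      have h2 : 0 ≤ 1 - s / δ := by
        rw [sub_nonneg, div_le_one hδpos]
        exact hsδ
      rw [dist_eq_norm, h1, norm_smul, Real.norm_of_nonneg h2, ← dist_eq_norm, ← hδ, sub_mul,
        one_mul, div_mul_cancel₀ _ hδpos.ne']
    have := hmin q hqU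
    linarith
  -- so `p ∈ P k` and `u ∈ D k`
  have hpP : p ∈ P k := by
    rw [hP]
    exact ⟨hpfr, mem_sphere_of_mem_frontier c r hpfr hk, hkmin⟩
  have huD : u ∈ D k := by
    rw [hD]
    exact ⟨hu1, by rw [hpu]; exact hpP⟩
  -- conclusion
  refine mem_iUnion.2 ⟨k, mem_vadd_set.2 ⟨x - c k, ⟨⟨sub_ne_zero.2 hxc, ?_⟩, ?_, ?_⟩, ?_⟩⟩
  · rw [← dist_eq_norm, hB]
    exact huD
  · rw [mem_closedBall_zero_iff, ← dist_eq_norm, hB]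
    linarith
  · rw [mem_closedBall_zero_iff, ← dist_eq_norm, not_le]
    exact hxk
  · rw [vadd_eq_add, add_sub_cancel]

/-- **Volume of one radial shell**: for `ρ ≥ 0`, `ε > 0` and a measurable set of directions `D`,
`vol(rayCone D ∩ (B̄(0, ρ+ε) \ B̄(0, ρ))) = ((ρ+ε)³ − ρ³) · (4π/3) · sphereFraction D`. [folklore] -/
private theorem volume_shell {D : Set (EuclideanSpace ℝ (Fin 3))} (hDm : MeasurableSet D) {ρ ε : ℝ} (hρ : 0 ≤ ρ)
    (hε : 0 < ε) :
    volume (rayCone D ∩ (closedBall (0 : (EuclideanSpace ℝ (Fin 3))) (ρ + ε) \ closedBall 0 ρ)) =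
      ENNReal.ofReal (((ρ + ε) ^ 3 - ρ ^ 3) * (sphereFraction D * (π * 4 / 3))) := by
  have hset : rayCone D ∩ (closedBall (0 : (EuclideanSpace ℝ (Fin 3))) (ρ + ε) \ closedBall 0 ρ) =
      (closedBall (0 : (EuclideanSpace ℝ (Fin 3))) (ρ + ε) ∩ rayCone D) \ (closedBall 0 ρ ∩ rayCone D) := by
    ext x
    simp only [mem_inter_iff, Set.mem_sdiff]
    tauto
  have hsub : closedBall (0 : (EuclideanSpace ℝ (Fin 3))) ρ ∩ rayCone D ⊆ closedBall 0 (ρ + ε) ∩ rayCone D :=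
    inter_subset_inter_left _ (closedBall_subset_closedBall (by linarith))
  have hfin : volume (closedBall (0 : (EuclideanSpace ℝ (Fin 3))) ρ ∩ rayCone D) ≠ ⊤ :=
    (lt_of_le_of_lt (measure_mono inter_subset_left)
      (isCompact_closedBall (0 : (EuclideanSpace ℝ (Fin 3))) ρ).measure_lt_top).ne
  have hK : 0 ≤ sphereFraction D * (π * 4 / 3) := mul_nonneg (sphereFraction_nonneg _) (by positivity)
  rw [hset, measure_sdiff hsub (measurableSet_closedBall.inter (measurableSet_rayCone hDm)).nullMeasurableSet hfin,
    volume_closedBall_inter_rayCone D (by linarith), volume_closedBall_inter_rayCone D hρ,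
    ← ENNReal.ofReal_sub _ (mul_nonneg (pow_nonneg hρ 3) hK), ← sub_mul]

/-- **Volume of the outer shell of the union**:
`vol((U + B̄(0,ε)) \ U) ≤ Σₖ ((r k + ε)³ − (r k)³) · (4π/3) · sphereFraction (D k)`. [folklore] -/
private theorem volume_add_closedBall_diff_le (P D : Fin m → Set (EuclideanSpace ℝ (Fin 3)))
    (hP : ∀ k, P k = frontier (⋃ j, closedBall (c j) (r j)) ∩
      (sphere (c k) (r k) ∩ {x | ∀ j < k, x ∉ closedBall (c j) (r j)}))
    (hD : ∀ k, D k = {u : (EuclideanSpace ℝ (Fin 3)) | ‖u‖ = 1 ∧ c k + r k • u ∈ P k}) {ε : ℝ} (hε : 0 < ε) :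
    volume (((⋃ j, closedBall (c j) (r j)) + closedBall (0 : (EuclideanSpace ℝ (Fin 3))) ε) \ (⋃ j, closedBall (c j) (r j)))
      ≤ ENNReal.ofReal (∑ k, ((r k + ε) ^ 3 - r k ^ 3) * (sphereFraction (D k) * (π * 4 / 3))) := by
  have hterm : ∀ k, volume (rayCone (D k) ∩ (closedBall (0 : (EuclideanSpace ℝ (Fin 3))) (r k + ε) \ closedBall 0 (r k)))
      ≤ ENNReal.ofReal (((r k + ε) ^ 3 - r k ^ 3) * (sphereFraction (D k) * (π * 4 / 3))) := by
    intro k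
    rcases lt_or_ge (r k) 0 with hneg | hnn
    · have hDk : D k = ∅ := dirs_eq_empty_of_neg c r P D hP hD hneg
      have h0 : rayCone (D k) = ∅ := by
        rw [hDk]; exact Set.eq_empty_iff_forall_notMem.2 fun x hx => hx.2
      rw [h0, empty_inter, measure_empty]
      exact bot_le
    · exact (volume_shell (measurableSet_dirs c r P D hP hD k) hnn hε).le
  have hnn : ∀ k, 0 ≤ ((r k + ε) ^ 3 - r k ^ 3) * (sphereFraction (D k) * (π * 4 / 3)) := by
    intro k
    refine mul_nonneg ?_ (mul_nonneg (sphereFraction_nonneg _) (by positivity))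
    have hmono := (Odd.strictMono_pow (R := ℝ) (by decide : Odd 3)).monotone
      (show r k ≤ r k + ε by linarith)
    exact sub_nonneg.2 hmono
  calc volume (((⋃ j, closedBall (c j) (r j)) + closedBall (0 : (EuclideanSpace ℝ (Fin 3))) ε) \ (⋃ j, closedBall (c j) (r j)))
      ≤ volume (⋃ k, (c k +ᵥ (rayCone (D k) ∩ (closedBall (0 : (EuclideanSpace ℝ (Fin 3))) (r k + ε) \ closedBall 0 (r k))))) :=
        measure_mono (add_closedBall_diff_subset c r P D hP hD ε)
    _ ≤ ∑ k, volume (c k +ᵥ (rayCone (D k) ∩ (closedBall (0 : (EuclideanSpace ℝ (Fin 3))) (r k + ε) \ closedBall 0 (r k)))) :=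
        measure_iUnion_fintype_le _ _
    _ = ∑ k, volume (rayCone (D k) ∩ (closedBall (0 : (EuclideanSpace ℝ (Fin 3))) (r k + ε) \ closedBall 0 (r k))) := by
        simp_rw [measure_vadd]
    _ ≤ ∑ k, ENNReal.ofReal (((r k + ε) ^ 3 - r k ^ 3) * (sphereFraction (D k) * (π * 4 / 3))) :=
        Finset.sum_le_sum fun k _ => hterm k
    _ = ENNReal.ofReal (∑ k, ((r k + ε) ^ 3 - r k ^ 3) * (sphereFraction (D k) * (π * 4 / 3))) :=
        (ENNReal.ofReal_sum_of_nonneg fun k _ => hnn k).symm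

end Shell

/-! ### Assembly: Brunn–Minkowski for `U + B̄(0,ε)` and the limit `ε → 0⁺` -/

section Assembly

/-- **The isoperimetric inequality for a finite union of closed balls indexed by `Fin m`.**
With `V = vol U`, `A = μHE[2](∂U) = Σₖ 4π rₖ² σₖ`: Brunn–Minkowski gives
`vol(U + B̄(0,ε)) ≥ (4π/3)(ρ + ε)³` where `(4π/3)ρ³ = V`, the shell bound gives
`vol(U + B̄(0,ε)) − V ≤ Σₖ (4π/3)((rₖ+ε)³ − rₖ³) σₖ`; dividing by `ε` and letting `ε → 0⁺`,
`4πρ² ≤ A`, whose cube is `36π V² ≤ A³`. [folklore] -/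
private theorem isoperimetric_iUnion_closedBall_fin {m : ℕ} (c : Fin m → (EuclideanSpace ℝ (Fin 3))) (r : Fin m → ℝ) :
    (μHE[2] : Measure (EuclideanSpace ℝ (Fin 3))) (frontier (⋃ j, closedBall (c j) (r j))) ≠ ⊤ ∧
      36 * π * ((volume (⋃ j, closedBall (c j) (r j))).toReal) ^ 2 ≤
        (((μHE[2] : Measure (EuclideanSpace ℝ (Fin 3))) (frontier (⋃ j, closedBall (c j) (r j)))).toReal) ^ 3 := by
  set U := ⋃ j, closedBall (c j) (r j) with hU
  -- the pieces of `∂U` and their direction sets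
  set P : Fin m → Set (EuclideanSpace ℝ (Fin 3)) := fun k =>
    frontier U ∩ (sphere (c k) (r k) ∩ {x | ∀ j < k, x ∉ closedBall (c j) (r j)}) with hPdef
  set D : Fin m → Set (EuclideanSpace ℝ (Fin 3)) := fun k => {u : (EuclideanSpace ℝ (Fin 3)) | ‖u‖ = 1 ∧ c k + r k • u ∈ P k} with hDdef
  have hP : ∀ k, P k = frontier (⋃ j, closedBall (c j) (r j)) ∩
      (sphere (c k) (r k) ∩ {x | ∀ j < k, x ∉ closedBall (c j) (r j)}) := fun k => rfl
  have hD : ∀ k, D k = {u : (EuclideanSpace ℝ (Fin 3)) | ‖u‖ = 1 ∧ c k + r k • u ∈ P k} := fun k => rfl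
  -- the area `A`
  set A : ℝ := ∑ k, 4 * π * r k ^ 2 * sphereFraction (D k) with hA
  have hA0 : 0 ≤ A :=
    Finset.sum_nonneg fun k _ => mul_nonneg (by positivity) (sphereFraction_nonneg _)
  have harea : (μHE[2] : Measure (EuclideanSpace ℝ (Fin 3))) (frontier U) = ENNReal.ofReal A :=
    euclideanHausdorff_frontier_eq c r P D hP hD
  refine ⟨by rw [harea]; exact ENNReal.ofReal_ne_top, ?_⟩
  rw [harea, ENNReal.toReal_ofReal hA0]
  -- the volume `V`
  have hUc : IsCompact U := isCompact_iUnion_closedBall' c r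
  have hUfin : volume U ≠ ⊤ := hUc.measure_lt_top.ne
  set V : ℝ := (volume U).toReal with hV
  have hV0 : 0 ≤ V := ENNReal.toReal_nonneg
  rcases hV0.eq_or_lt with hV00 | hVpos
  · rw [← hV00]
    have : 0 ≤ A ^ 3 := pow_nonneg hA0 3
    nlinarith
  have hUne : U.Nonempty := by
    by_contra h
    rw [Set.not_nonempty_iff_eq_empty] at h
    rw [hV, h, measure_empty, ENNReal.toReal_zero] at hVpos
    exact lt_irrefl _ hVpos
  -- cube roots: `K = 4π/3 = κ³`, `V = a³`, `ρ = a/κ`, so `V = K ρ³`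
  set K : ℝ := π * 4 / 3 with hK
  have hKpos : 0 < K := by positivity
  set κ : ℝ := K ^ (((3 : ℕ) : ℝ)⁻¹) with hκ
  have hκpos : 0 < κ := Real.rpow_pos_of_pos hKpos _
  have hκ3 : κ ^ 3 = K := Real.rpow_inv_natCast_pow hKpos.le (by norm_num)
  set a : ℝ := V ^ (((3 : ℕ) : ℝ)⁻¹) with ha
  have ha0 : 0 ≤ a := Real.rpow_nonneg hV0 _
  have ha3 : a ^ 3 = V := Real.rpow_inv_natCast_pow hV0 (by norm_num)
  set ρ : ℝ := a / κ with hρ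
  have hρ0 : 0 ≤ ρ := div_nonneg ha0 hκpos.le
  have haρ : a = κ * ρ := by
    rw [hρ]
    field_simp
  have hVρ : V = K * ρ ^ 3 := by rw [← ha3, haρ, mul_pow, hκ3]
  -- the key inequality for every `ε > 0`
  have hstep : ∀ ε : ℝ, 0 < ε →
      K * ((ρ + ε) ^ 3 - ρ ^ 3) ≤ ∑ k, ((r k + ε) ^ 3 - r k ^ 3) * (sphereFraction (D k) * K) := by
    intro ε hε
    have hWc : IsCompact (U + closedBall (0 : (EuclideanSpace ℝ (Fin 3))) ε) := hUc.add (isCompact_closedBall 0 ε)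
    have hWfin : volume (U + closedBall (0 : (EuclideanSpace ℝ (Fin 3))) ε) ≠ ⊤ := hWc.measure_lt_top.ne
    -- Brunn–Minkowski: `K (ρ + ε)³ ≤ vol(U + B̄(0,ε))`
    have hAvol : ENNReal.ofReal ((κ * ρ) ^ 3) ≤ volume U := by
      rw [← haρ, ha3, hV, ENNReal.ofReal_toReal hUfin]
    have hBvol : ENNReal.ofReal ((κ * ε) ^ 3) ≤ volume (closedBall (0 : (EuclideanSpace ℝ (Fin 3))) ε) := by
      rw [mul_pow, hκ3, mul_comm, ENNReal.ofReal_mul (pow_nonneg hε.le _), ENNReal.ofReal_pow hε.le,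
        EuclideanSpace.volume_closedBall_fin_three]
    have hBM := Literature.Analysis.Convexity.brunnMinkowski_pow_of_isCompact hUc
      (isCompact_closedBall (0 : (EuclideanSpace ℝ (Fin 3))) ε) hUne (nonempty_closedBall.2 hε.le)
      (mul_nonneg hκpos.le hρ0) (mul_nonneg hκpos.le hε.le) hAvol hBvol
    have hW : K * (ρ + ε) ^ 3 ≤ (volume (U + closedBall (0 : (EuclideanSpace ℝ (Fin 3))) ε)).toReal := by
      have h1 : (κ * ρ + κ * ε) ^ 3 = K * (ρ + ε) ^ 3 := by rw [← mul_add, mul_pow, hκ3]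
      rw [← h1]
      exact (ENNReal.ofReal_le_iff_le_toReal hWfin).1 hBM
    -- the shell: `vol(U + B̄(0,ε)) − V ≤ Σₖ ((rₖ+ε)³ − rₖ³) σₖ K`
    have hsubW : U ⊆ U + closedBall (0 : (EuclideanSpace ℝ (Fin 3))) ε := fun u hu =>
      ⟨u, hu, 0, mem_closedBall_self hε.le, add_zero u⟩
    have hdiff : (volume ((U + closedBall (0 : (EuclideanSpace ℝ (Fin 3))) ε) \ U)).toReal =
        (volume (U + closedBall (0 : (EuclideanSpace ℝ (Fin 3))) ε)).toReal - V := by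
      rw [measure_sdiff hsubW hUc.measurableSet.nullMeasurableSet hUfin,
        ENNReal.toReal_sub_of_le (measure_mono hsubW) hWfin]
    have hnn : 0 ≤ ∑ k, ((r k + ε) ^ 3 - r k ^ 3) * (sphereFraction (D k) * K) := by
      refine Finset.sum_nonneg fun k _ => mul_nonneg ?_ (mul_nonneg (sphereFraction_nonneg _) hKpos.le)
      have hmono := (Odd.strictMono_pow (R := ℝ) (by decide : Odd 3)).monotone
        (show r k ≤ r k + ε by linarith)
      exact sub_nonneg.2 hmono
    have hshell : (volume ((U + closedBall (0 : (EuclideanSpace ℝ (Fin 3))) ε) \ U)).toReal ≤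
        ∑ k, ((r k + ε) ^ 3 - r k ^ 3) * (sphereFraction (D k) * K) :=
      ENNReal.toReal_le_of_le_ofReal hnn (volume_add_closedBall_diff_le c r P D hP hD hε)
    rw [hdiff] at hshell
    have e1 : K * ((ρ + ε) ^ 3 - ρ ^ 3) = K * (ρ + ε) ^ 3 - V := by rw [hVρ]; ring
    rw [e1]
    linarith
  -- divide by `ε` and let `ε → 0⁺`
  have hfg : ∀ ε, 0 < ε → K * (3 * ρ ^ 2 + 3 * ρ * ε + ε ^ 2) ≤
      ∑ k, (3 * r k ^ 2 + 3 * r k * ε + ε ^ 2) * (sphereFraction (D k) * K) := by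
    intro ε hε
    have h := hstep ε hε
    have e1 : K * ((ρ + ε) ^ 3 - ρ ^ 3) = ε * (K * (3 * ρ ^ 2 + 3 * ρ * ε + ε ^ 2)) := by ring
    have e2 : ∑ k, ((r k + ε) ^ 3 - r k ^ 3) * (sphereFraction (D k) * K) =
        ε * ∑ k, (3 * r k ^ 2 + 3 * r k * ε + ε ^ 2) * (sphereFraction (D k) * K) := by
      rw [Finset.mul_sum]
      exact Finset.sum_congr rfl fun k _ => by ring
    rw [e1, e2] at h
    exact le_of_mul_le_mul_left h hε
  have hf : Tendsto (fun ε : ℝ => K * (3 * ρ ^ 2 + 3 * ρ * ε + ε ^ 2)) (𝓝[>] 0)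
      (𝓝 (K * (3 * ρ ^ 2))) := by
    have hc : Continuous fun ε : ℝ => K * (3 * ρ ^ 2 + 3 * ρ * ε + ε ^ 2) := by fun_prop
    refine tendsto_nhdsWithin_of_tendsto_nhds ?_
    convert hc.tendsto 0 using 2
    ring
  have hg : Tendsto (fun ε : ℝ => ∑ k, (3 * r k ^ 2 + 3 * r k * ε + ε ^ 2) * (sphereFraction (D k) * K))
      (𝓝[>] 0) (𝓝 (∑ k, 3 * r k ^ 2 * (sphereFraction (D k) * K))) := by
    have hc : Continuous fun ε : ℝ =>
        ∑ k, (3 * r k ^ 2 + 3 * r k * ε + ε ^ 2) * (sphereFraction (D k) * K) := by fun_prop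
    refine tendsto_nhdsWithin_of_tendsto_nhds ?_
    convert hc.tendsto 0 using 2
    exact Finset.sum_congr rfl fun k _ => by ring
  have hlim : K * (3 * ρ ^ 2) ≤ ∑ k, 3 * r k ^ 2 * (sphereFraction (D k) * K) :=
    le_of_tendsto_of_tendsto hf hg (eventually_nhdsWithin_of_forall fun ε hε => hfg ε hε)
  -- `4πρ² ≤ A`, and cube
  have e3 : ∑ k, 3 * r k ^ 2 * (sphereFraction (D k) * K) = A := by
    rw [hA]
    exact Finset.sum_congr rfl fun k _ => by rw [hK]; ring
  have e4 : K * (3 * ρ ^ 2) = 4 * π * ρ ^ 2 := by rw [hK]; ring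
  have h4 : 4 * π * ρ ^ 2 ≤ A := by rw [← e3, ← e4]; exact hlim
  calc 36 * π * V ^ 2 = (4 * π * ρ ^ 2) ^ 3 := by rw [hVρ, hK]; ring
    _ ≤ A ^ 3 := pow_le_pow_left₀ (by positivity) h4 3

end Assembly

/-- **Federer's isoperimetric inequality for finite unions of closed balls in `ℝ³` — DISCHARGED.**
For every finite family of closed balls `B̄(cᵢ, rᵢ) ⊆ ℝ³` with union `U`, the boundary `∂U`
has finite area and `36π · vol(U)² ≤ μHE[2](∂U)³`.  This is
`Federer1969_isoperimetricUnionBalls` (`SphericalIsoperimetric.lean`: Federer 3.2.43 with 3.2.39,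
specialised), proved here by Brunn–Minkowski (`Literature.Analysis.Convexity.brunnMinkowski_pow`,
from the tree's Prékopa–Leindler) applied to `U + B̄(0,ε)`, a nearest-point description of the
shell `(U + B̄(0,ε)) \ U` over a Borel partition of `∂U` into sphere pieces, the exact area of
those pieces (`μHE[2] = 4π r² · sphereFraction` on spheres, the tree's
`comap_euclideanHausdorff_eq_toSphere`), and the limit `ε → 0⁺` — i.e. the outer Minkowski
content route of [Gardner 2002, §5 with (13)] / [Federer 3.2.43] carried out for unions of balls,
where the Minkowski content is computed by hand. [cite: Federer1969, §3.2.43 and §3.2.39] -/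
theorem Federer1969_isoperimetricUnionBalls_holds : Federer1969_isoperimetricUnionBalls := by
  intro ι _ c r
  classical
  set e := Fintype.equivFin ι with he
  have hU : (⋃ i, closedBall (c i) (r i)) =
      ⋃ k : Fin (Fintype.card ι), closedBall (c (e.symm k)) (r (e.symm k)) :=
    (e.symm.surjective.iUnion_comp fun i => closedBall (c i) (r i)).symm
  rw [hU]
  exact isoperimetric_iUnion_closedBall_fin (fun k => c (e.symm k)) (fun k => r (e.symm k))

end Literature.Geometry.DiscreteGeometry

end
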